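import Summits.RiemannHypothesis.RiemannHypothesis.Theorems.TiltedLandingLaw421R3JensenDipQuant

/-!
# lens-1 (rh33346) — module W (part A = §W1–W2; part B = `…R3Lens1CoverageW`): the WEIGHTED quantitative Jensen dip
(answer to critic g24's L-far kernel inhabitant and to (CA462)(2)'s «identity-based bound»)

Ideation workfile; nothing here bears on the truth of RH; RH is not proved; 33346/33347 OPEN.

Critic g24 (bus 2026-08-30T20:33:44Z) exhibited an inhabitant of the L-far cell `CellL ∧ ¬LandingDipDeep ∧ ¬LandingDipQ` in a CORNER frame:
`Pw = z(z²+1)(z²+4)`, `v = i` on the lateral edge and at the band top, dip `xs = 0`, `m = 4`, `2A = 30`, cone zeros of `Pw′` at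
`±i√r₁, ±i√r₂` (`r₁ ≈ 0.296`, `r₂ ≈ 2.704`), so `N = 4` and `succ_of_dip_edge` needs `h² > 8/15` while the corner window allows only
`h² ≤ 1/2` — although the low pair `±i√r₁` IS in the level-1 window.  The loss is the CRUDE budget: each cone zero is charged `1/h²`
regardless of its height.  The sharp form of the removal argument charges a cone zero `a` exactly `1/(Im a)²`:

* `logDeriv2_remove` + `jensenDip_quantW` / `jensenDip_quantWR` (§W1): removing a dividing list of zeros `Rm` shifts `Re((g′/g)′(x))` by the
  exact charges `Σ Re(1/(x − b)²)` (a REAL zero: `+1/(x − r)²`; a conjugate pair outside the closed cone: `≥ 0`), and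
  `Re((g′/g)′(x)) + Σ_{b ∈ Rm} Re(1/(x − b)²) ≤ B` whenever every dividing list `A` of cone zeros has `Σ_{a∈A} 1/(Im a)² ≤ B`
  (NO height floor; the count budget `N` only terminates the removal).  This is the IDENTITY-BASED sharpening of the Jensen radius the
  director asked for ((CA462)(2): «one cone pair + END-type far-field budget»): with one cone pair at height `t` and far-field charge
  `E`, `2/t² ≥ 2A/m + E`, i.e. `t ≤ √(2/(2A/m + E)) < h_J`.
* `succ_of_dip_edgeWR` (§W2, frame corollary; `succ_of_dip_edgeW` = the case `Rm = []`): dip jets + a height `h > 0` inside the LATERAL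
  window + a weighted budget `Bw` for the cone zeros of height `≥ h` + a removed list `Rm` with `Bw·|m| < 2·|A| + |m|·E` ⇒ a successor
  at level `j+1` (the count budget is DERIVED from the strip `|Im a| ≤ Hs`: a floor list has length `≤ Bw·Hs²`).  On g24's corner
  exhibit: `h = 0.7`, `Bw = 2/r₂ ≈ 0.74`, `Rm = []`: `Bw·m ≈ 2.96 < 30` ✓, window `2·0.49 ≤ 1` ✓ — discharged.
* §W3–W4 (namespace `RhW08.Lens1Coverage`): cell datum `LandingDipW ⊇ LandingDipQ` (`landingDipW_of_Q`; data `h, Bw, Rm`), PROVED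
  `regime_LW`, the weaker residual stub `RegLfarW8` (`regLfarW8_of_regLfar8`), and the v5 composition
  `TiltedLandingLaw421R_of_regimes5 : RegCov8 → RegLfarW8 → RegEres8 → RateLawsHalfQ → crux` (+ sanity `_of_regimes4'`).
Instrument clause (K-C5W, per L row): `h_win` := the largest `h` with the lateral window clause; `Bw := Σ_{cone zeros a, |Im a| ≥ h_win} 1/(Im a)²`
(with multiplicity); `E := Σ_{tracked real zeros r of g} 1/(xs − r)² + Σ_{tracked pairs b outside the closed cone} 2(s² − t²)/(s² + t²)²`
(any certified SUBSET is admissible — every term is ≥ 0); certify `Bw·|m| < 2·|A| + |m|·E`.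
-/

set_option linter.unusedVariables false
set_option linter.unusedSectionVars false

noncomputable section

open Complex Set Filter Metric Topology
open scoped ComplexConjugate
open Literature.Analysis.Complex
open Summit.RiemannHypothesis.RiemannHypothesis.Theorems.Splittings.JensenWindow
open RhIdea6.G17.W07C7 RhIdea6.G17.W07C7.Rev6 RhIdea6.G18.W07C8.Law421BirthS RhIdea6.G19.W07C11.Seam
open RhIdea6.G20.W07C12.Frac RhIdea6.G20.W07C12.StColP RhW07.C12.FieldSplit RhIdea6.G21.W07C13.TentMax
open RhW07.C14.TwoSided RhW07.C14.Classes RhW07.C14.Lineage RhW07.C14.Booking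
open RhW07.C13.Heredity RhIdea6.G22.W07C15pre.Injection RhW07.E3.Cell RhW07.E3.Lit
open RhW08.Round1 RhW08.StSwap RhW08.Round2 RhW08.QuadW RhW08.SealSwapQ RhW08.SealSwap RhW08.SuccB RhW08.SuccSplit
open RhW08.SuccTheft RhW08.Column RhW08.Hurwitz RhW08.ClusterQ RhW08.ClusterQM RhW08.NewtonDoor RhW08.NewtonDoorGenusOne RhW08.PurseP
open RhW08.AntiEscapeSplit7

namespace RhW08.Lens1Quant

/-! ## §W1 The weighted quantitative Jensen dip -/

/-- The product of linear factors `z ↦ Π_{b ∈ Rm} (z − b)` is differentiable. -/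
theorem differentiable_listProd (Rm : List ℂ) : Differentiable ℂ (fun z : ℂ => (Rm.map (fun b => z - b)).prod) := by
  induction Rm with
  | nil => simp
  | cons b Rm ih =>
    have e : (fun z : ℂ => ((b :: Rm).map (fun b' => z - b')).prod) = fun z => (z - b) * (Rm.map (fun b' => z - b')).prod := by
      funext z; simp [List.map_cons, List.prod_cons]
    rw [e]
    exact (differentiable_id.sub_const b).mul ih

/-- **ZERO REMOVAL WITH EXACT CHARGES.**  Removing a list `Rm` of zeros whose linear factors jointly divide `g` (`g = Π(z − b)·q`) keeps
the growth class and shifts the second logarithmic derivative by the explicit charges: `Re((q′/q)′(x)) = Re((g′/g)′(x)) + Σ_{b ∈ Rm} Re(1/(x − b)²)`.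
(A REAL zero `r` contributes `+1/(x − r)² > 0`; a conjugate pair `b, b̄` outside the closed Jensen cone of `x` contributes `≥ 0`.) -/
theorem logDeriv2_remove {ρ : ℝ} (hρ0 : 0 ≤ ρ) {x : ℂ} :
    ∀ (Rm : List ℂ) {g : ℂ → ℂ} {C : ℝ}, Differentiable ℂ g → (∀ z, ‖g z‖ ≤ C * Real.exp (‖z‖ ^ ρ)) → g x ≠ 0 →
      ∀ {q : ℂ → ℂ}, Differentiable ℂ q → (∀ z, g z = (Rm.map (fun b => z - b)).prod * q z) →
        (∃ C' : ℝ, ∀ z, ‖q z‖ ≤ C' * Real.exp (‖z‖ ^ ρ)) ∧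
          (deriv (fun z => deriv q z / q z) x).re =
            (deriv (fun z => deriv g z / g z) x).re + (Rm.map (fun b => ((1 : ℂ) / (x - b) ^ 2).re)).sum := by
  intro Rm
  induction Rm with
  | nil =>
    intro g C hg hgr hx q hq hfac
    have hqg : q = g := funext fun z => by simpa using (hfac z).symm
    subst hqg
    exact ⟨⟨C, hgr⟩, by simp⟩
  | cons b Rm ih =>
    intro g C hg hgr hx q hq hfac
    set g' : ℂ → ℂ := fun z => (Rm.map (fun b' => z - b')).prod * q z with hg'def
    have hg'd : Differentiable ℂ g' := (differentiable_listProd Rm).mul hq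
    have hfac1 : ∀ z, g z = (z - b) * g' z := by
      intro z; rw [hfac z, List.map_cons, List.prod_cons, mul_assoc]
    have hgb : g b = 0 := by rw [hfac1 b, sub_self, zero_mul]
    -- `dslope g b = g'`
    have hds : dslope g b = g' := by
      funext z
      by_cases hzb : z = b
      · rw [hzb, dslope_same]
        have hfun : g = fun z => (z - b) * g' z := funext hfac1
        have h1 : HasDerivAt (fun z => (z - b) * g' z) (1 * g' b + (b - b) * deriv g' b) b :=
          ((hasDerivAt_id b).sub_const b).mul hg'd.differentiableAt.hasDerivAt
        rw [sub_self, zero_mul, add_zero, one_mul] at h1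
        rw [hfun]; exact h1.deriv
      · rw [dslope_of_ne _ hzb, slope_def_module, hgb, sub_zero, hfac1 z, smul_eq_mul]
        field_simp [sub_ne_zero.2 hzb]
    obtain ⟨-, -, hgr'⟩ := growth_dslope hg hρ0 hgr hgb
    rw [hds] at hgr'
    have hx' : g' x ≠ 0 := by
      intro h0; apply hx; rw [hfac1 x, h0, mul_zero]
    have hshift := logDeriv2_factor hg hg'd hfac1 hx
    obtain ⟨hC'', hid⟩ := ih hg'd hgr' hx' hq (fun z => rfl)
    refine ⟨hC'', ?_⟩
    rw [hid, hshift, Complex.add_re, List.map_cons, List.sum_cons]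
    ring

/-- **WEIGHTED QUANTITATIVE JENSEN DIP** (zero removal with exact charges).  `g` entire of order `< 2` (growth `‖g z‖ ≤ C·exp(‖z‖^ρ)`,
`ρ < 2`), `g(x) ≠ 0` at a real `x`; a count budget `N` for dividing lists of cone zeros (termination only); and a WEIGHT budget `B`:
every list `A` of zeros of `g` in the open Jensen cone `|x − Re a| < |Im a|` whose linear factors jointly divide `g` has
`Σ_{a ∈ A} 1/(Im a)² ≤ B`.  Then `Re((g′/g)′(x)) ≤ B`.  (No height floor.  With a floor `h ≤ |Im a|` and `B = N/h²` this is
`jensenDip_quant`.) -/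
theorem jensenDip_quantW {g : ℂ → ℂ} (hg : Differentiable ℂ g) {ρ C : ℝ} (hρ0 : 0 ≤ ρ) (hρ : ρ < 2)
    (hgr : ∀ z, ‖g z‖ ≤ C * Real.exp (‖z‖ ^ ρ)) {x : ℝ} (hx : g x ≠ 0) {N : ℕ}
    (hN : ∀ A : List ℂ, (∀ a ∈ A, g a = 0 ∧ |x - a.re| < |a.im|) →
      (∃ q : ℂ → ℂ, Differentiable ℂ q ∧ ∀ z, g z = (A.map (fun a => z - a)).prod * q z) → A.length ≤ N)
    {B : ℝ} (hB : ∀ A : List ℂ, (∀ a ∈ A, g a = 0 ∧ |x - a.re| < |a.im|) →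
      (∃ q : ℂ → ℂ, Differentiable ℂ q ∧ ∀ z, g z = (A.map (fun a => z - a)).prod * q z) →
        (A.map (fun a => 1 / a.im ^ 2)).sum ≤ B) :
    (deriv (fun z => deriv g z / g z) x).re ≤ B := by
  set δ : ℝ := (deriv (fun z => deriv g z / g z) x).re with hδ
  by_contra hlt
  push Not at hlt
  have key : ∀ k : ℕ, k ≤ N + 1 → ∃ (A : List ℂ) (q : ℂ → ℂ) (C' : ℝ), A.length = k ∧
      (∀ a ∈ A, g a = 0 ∧ |x - a.re| < |a.im|) ∧ Differentiable ℂ q ∧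
      (∀ z, ‖q z‖ ≤ C' * Real.exp (‖z‖ ^ ρ)) ∧ (∀ z, g z = (A.map (fun a => z - a)).prod * q z) ∧
      δ - (A.map (fun a => 1 / a.im ^ 2)).sum ≤ (deriv (fun z => deriv q z / q z) x).re := by
    intro k
    induction k with
    | zero =>
      intro _
      refine ⟨[], g, C, rfl, by simp, hg, hgr, fun z => by simp, ?_⟩
      simp [hδ]
    | succ k ih =>
      intro hk
      obtain ⟨A, q, C', hlen, hmem, hqd, hqg, hfac, hbd⟩ := ih (by omega)
      have hqx : q x ≠ 0 := by
        intro h0; apply hx; rw [hfac x, h0, mul_zero]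
      have hsum : (A.map (fun a => 1 / a.im ^ 2)).sum ≤ B := hB A hmem ⟨q, hqd, hfac⟩
      have hpos : 0 < (deriv (fun z => deriv q z / q z) x).re := by linarith
      obtain ⟨a, ha, hca⟩ := jensenDipLog hqd hρ0 hρ hqg hqx hpos
      have hga : g a = 0 := by rw [hfac a, ha, mul_zero]
      have haim0 : a.im ≠ 0 := by
        intro h0; rw [h0, abs_zero] at hca; exact absurd hca (not_lt.2 (abs_nonneg _))
      obtain ⟨hrd, hqr, hrg⟩ := growth_dslope hqd hρ0 hqg ha
      refine ⟨a :: A, dslope q a, C' * Real.exp ((‖a‖ + 1) ^ ρ), by simp [hlen], ?_, hrd, hrg, ?_, ?_⟩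
      · intro b hb
        rcases List.mem_cons.1 hb with h' | h'
        · rw [h']; exact ⟨hga, hca⟩
        · exact hmem b h'
      · intro z
        rw [hfac z, hqr z, List.map_cons, List.prod_cons]
        ring
      · have hshift := logDeriv2_factor hqd hrd hqr hqx
        have hpole : -(1 / a.im ^ 2) ≤ ((1 : ℂ) / ((x : ℂ) - a) ^ 2).re := by
          have hw : ((x : ℂ) - a).im ≠ 0 := by simpa using haim0
          have h1 := re_inv_sq_ge hw
          have e : ((1 : ℂ) / ((x : ℂ) - a) ^ 2) = (((x : ℂ) - a) ^ 2)⁻¹ := one_div _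
          rw [e]
          have him : ((x : ℂ) - a).im = -a.im := by simp
          rw [him, neg_sq] at h1
          exact h1
        rw [hshift, Complex.add_re, List.map_cons, List.sum_cons]
        linarith
  obtain ⟨A, q, C', hlen, hmem, hqd, hqg, hfac, -⟩ := key (N + 1) le_rfl
  have := hN A hmem ⟨q, hqd, hfac⟩
  omega

/-- **WEIGHTED QUANTITATIVE JENSEN DIP WITH REMOVED ZEROS.**  As `jensenDip_quantW`, after removing any list `Rm` of zeros whose linear
factors jointly divide `g`: `Re((g′/g)′(x)) + Σ_{b ∈ Rm} Re(1/(x − b)²) ≤ B`.  Every removed REAL zero and every removed conjugate pair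
outside the closed cone adds a NONNEGATIVE charge on the left — the identity-based sharpening of the Jensen radius (far-field budget). -/
theorem jensenDip_quantWR {g : ℂ → ℂ} (hg : Differentiable ℂ g) {ρ C : ℝ} (hρ0 : 0 ≤ ρ) (hρ : ρ < 2)
    (hgr : ∀ z, ‖g z‖ ≤ C * Real.exp (‖z‖ ^ ρ)) {x : ℝ} (hx : g x ≠ 0) {N : ℕ}
    (hN : ∀ A : List ℂ, (∀ a ∈ A, g a = 0 ∧ |x - a.re| < |a.im|) →
      (∃ q : ℂ → ℂ, Differentiable ℂ q ∧ ∀ z, g z = (A.map (fun a => z - a)).prod * q z) → A.length ≤ N)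
    {B : ℝ} (hB : ∀ A : List ℂ, (∀ a ∈ A, g a = 0 ∧ |x - a.re| < |a.im|) →
      (∃ q : ℂ → ℂ, Differentiable ℂ q ∧ ∀ z, g z = (A.map (fun a => z - a)).prod * q z) →
        (A.map (fun a => 1 / a.im ^ 2)).sum ≤ B)
    (Rm : List ℂ) (hRm : ∃ q : ℂ → ℂ, Differentiable ℂ q ∧ ∀ z, g z = (Rm.map (fun b => z - b)).prod * q z) :
    (deriv (fun z => deriv g z / g z) x).re + (Rm.map (fun b => ((1 : ℂ) / ((x : ℂ) - b) ^ 2).re)).sum ≤ B := by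
  obtain ⟨q, hq, hfac⟩ := hRm
  obtain ⟨⟨C', hqr⟩, hid⟩ := logDeriv2_remove hρ0 Rm hg hgr hx hq hfac
  have hqx : q x ≠ 0 := by
    intro h0; apply hx; rw [hfac x, h0, mul_zero]
  have hNq : ∀ A : List ℂ, (∀ a ∈ A, q a = 0 ∧ |x - a.re| < |a.im|) →
      (∃ q' : ℂ → ℂ, Differentiable ℂ q' ∧ ∀ z, q z = (A.map (fun a => z - a)).prod * q' z) → A.length ≤ N := by
    intro A hA hq'
    obtain ⟨q', hq'd, hfac'⟩ := hq'
    refine hN A (fun a ha => ⟨by rw [hfac a, (hA a ha).1, mul_zero], (hA a ha).2⟩)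
      ⟨fun z => (Rm.map (fun b => z - b)).prod * q' z, (differentiable_listProd Rm).mul hq'd, fun z => ?_⟩
    rw [hfac z, hfac' z]; ring
  have hBq : ∀ A : List ℂ, (∀ a ∈ A, q a = 0 ∧ |x - a.re| < |a.im|) →
      (∃ q' : ℂ → ℂ, Differentiable ℂ q' ∧ ∀ z, q z = (A.map (fun a => z - a)).prod * q' z) →
        (A.map (fun a => 1 / a.im ^ 2)).sum ≤ B := by
    intro A hA hq'
    obtain ⟨q', hq'd, hfac'⟩ := hq'
    refine hB A (fun a ha => ⟨by rw [hfac a, (hA a ha).1, mul_zero], (hA a ha).2⟩)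
      ⟨fun z => (Rm.map (fun b => z - b)).prod * q' z, (differentiable_listProd Rm).mul hq'd, fun z => ?_⟩
    rw [hfac z, hfac' z]; ring
  have := jensenDip_quantW hq hρ0 hρ hqr hqx hNq hBq
  rw [hid] at this
  exact this

/-! ## §W2 The weighted EDGE-dip successor in the frame -/

/-- **WEIGHTED EDGE-DIP SUCCESSOR WITH FAR-FIELD BUDGET.**  Frame `EngineHyps5 2 …`; a non-crossing dip of `g := f^{(j+1)}` at a real
`xs` (`m = g(xs)`, `g′(xs) = 0`, `2A = g″(xs)`, `0 < m·A`); a height `h > 0` with the LATERAL window clause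
`max(|xs − x₀| + h − R/2, 0)² + (j+1)·h² ≤ (j+1)·Hs²`; a WEIGHT budget `Bw` for the cone zeros ABOVE `h` (every list of zeros `a` of `g`
with `|xs − Re a| < |Im a|` and `h ≤ |Im a|` whose linear factors jointly divide `g` has `Σ 1/(Im a)² ≤ Bw`); and a REMOVED LIST `Rm` of
zeros of `g` (linear factors jointly dividing `g`; typically nearby REAL zeros and lateral pairs OUTSIDE the cone) with total charge
`E := Σ_{b ∈ Rm} Re(1/(xs − b)²)`.  If `Bw·|m| < 2·|A| + |m|·E` then level `j+1` carries a band state.  (No count budget: it is derived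
from the strip.  `Rm = []`, `Bw = N/h²` is `succ_of_dip_edge`.) -/
theorem succ_of_dip_edgeWR {η : ℝ} {f : ℂ → ℂ} {x₀ s hmax R Hs : ℝ} {B j : ℕ}
    (hE : EngineHyps5 2 η f x₀ s hmax R Hs B) {xs m A : ℝ}
    (hm : (m : ℂ) = iteratedDeriv (j + 1) f xs) (h2 : iteratedDeriv (j + 2) f xs = 0)
    (hA : ((2 * A : ℝ) : ℂ) = iteratedDeriv (j + 3) f xs) (hmA : 0 < m * A)
    {h : ℝ} (hh : 0 < h) {Bw : ℝ}
    (hB : ∀ L : List ℂ, (∀ a ∈ L, iteratedDeriv (j + 1) f a = 0 ∧ |xs - a.re| < |a.im| ∧ h ≤ |a.im|) →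
      (∃ q : ℂ → ℂ, Differentiable ℂ q ∧ ∀ z, iteratedDeriv (j + 1) f z = (L.map (fun a => z - a)).prod * q z) →
        (L.map (fun a => 1 / a.im ^ 2)).sum ≤ Bw)
    (Rm : List ℂ) (hRm : ∃ q : ℂ → ℂ, Differentiable ℂ q ∧ ∀ z, iteratedDeriv (j + 1) f z = (Rm.map (fun b => z - b)).prod * q z)
    (hBm : Bw * |m| < 2 * |A| + |m| * (Rm.map (fun b => ((1 : ℂ) / ((xs : ℂ) - b) ^ 2).re)).sum)
    (hwin : (max (|xs - x₀| + h - R / 2) 0) ^ 2 + ((j : ℝ) + 1) * h ^ 2 ≤ ((j : ℝ) + 1) * Hs ^ 2) :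
    ∃ u : ℂ, StTrkDQ η f x₀ s hmax R Hs B (j + 1) u := by
  obtain ⟨hdiff, hreal, hgrowth, hs, hsh, hhR, h3R, hHs, hstrip, hHsR, hpair, hcol, hhalf, hη0, hη1, hrem⟩ := hE
  have hE' : EngineHyps5 2 η f x₀ s hmax R Hs B :=
    ⟨hdiff, hreal, hgrowth, hs, hsh, hhR, h3R, hHs, hstrip, hHsR, hpair, hcol, hhalf, hη0, hη1, hrem⟩
  set g : ℂ → ℂ := iteratedDeriv (j + 1) f with hg_def
  have hgd : Differentiable ℂ g := differentiable_iteratedDeriv_of_entire hdiff (j + 1)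
  have hC0 : InClass f Hs := ⟨hdiff, hreal, hgrowth, hstrip⟩
  have hm0 : m ≠ 0 := by
    intro h0; rw [h0, zero_mul] at hmA; exact lt_irrefl _ hmA
  have hgx : g xs ≠ 0 := by
    rw [← hm]; exact_mod_cast hm0
  have hgne : g ≠ 0 := by
    intro h0; exact hgx (by rw [h0]; rfl)
  have hCj : InClass g Hs := analyticHeredity_landed f Hs (j + 1) hHs hC0 hgne
  obtain ⟨ρ', C', hρ'0, hρ', -, hgr'⟩ := StubAnalyticHeredity.growth_treeForm hgd hCj.2.2.1
  -- `(g′/g)′(xs) = 2A/m`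
  have hdg : Differentiable ℂ (deriv g) := by
    have := differentiable_iteratedDeriv_of_entire hgd 1
    simpa [iteratedDeriv_one] using this
  have hx1 : deriv g xs = 0 := by
    rw [hg_def, ← iteratedDeriv_succ]; exact h2
  have hL : deriv (fun z => deriv g z / g z) xs = deriv (deriv g) xs / g xs := by
    have h : HasDerivAt (fun z => deriv g z / g z)
        ((deriv (deriv g) xs * g xs - deriv g xs * deriv g xs) / g xs ^ 2) xs :=
      (hdg.differentiableAt.hasDerivAt (x := (xs : ℂ))).div (hgd.differentiableAt.hasDerivAt) hgx
    rw [h.deriv, hx1]; field_simp; ring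
  have hδ : (deriv (fun z => deriv g z / g z) xs).re = 2 * A / m := by
    have e : deriv (deriv g) = iteratedDeriv (j + 3) f := by
      rw [hg_def, ← iteratedDeriv_succ, ← iteratedDeriv_succ]
    rw [hL, e, ← hA, ← hm, ← Complex.ofReal_div, Complex.ofReal_re]
  set E : ℝ := (Rm.map (fun b => ((1 : ℂ) / ((xs : ℂ) - b) ^ 2).re)).sum with hE_def
  have hδB : Bw < (deriv (fun z => deriv g z / g z) xs).re + E := by
    rw [hδ]
    have hAm : 2 * A / m = 2 * |A| / |m| := by
      rcases lt_or_gt_of_ne hm0 with hneg | hpos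
      · have hA' : A < 0 := by nlinarith
        rw [abs_of_neg hneg, abs_of_neg hA']; ring
      · have hA' : 0 < A := by nlinarith
        rw [abs_of_pos hpos, abs_of_pos hA']
    have hmpos : 0 < |m| := abs_pos.2 hm0
    have e2 : 2 * |A| / |m| + E = (2 * |A| + |m| * E) / |m| := by
      field_simp
    rw [hAm, e2, lt_div_iff₀ hmpos]
    exact hBm
  -- hence a cone zero of height `< h`
  have hex : ∃ a, g a = 0 ∧ |xs - a.re| < |a.im| ∧ |a.im| < h := by
    by_contra hcon
    push Not at hcon
    -- under the floor, the weight budget applies to every dividing cone list …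
    have hB' : ∀ A' : List ℂ, (∀ a ∈ A', g a = 0 ∧ |xs - a.re| < |a.im|) →
        (∃ q : ℂ → ℂ, Differentiable ℂ q ∧ ∀ z, g z = (A'.map (fun a => z - a)).prod * q z) →
          (A'.map (fun a => 1 / a.im ^ 2)).sum ≤ Bw := fun A' hA' hq =>
      hB A' (fun a ha => ⟨(hA' a ha).1, (hA' a ha).2, hcon a (hA' a ha).1 (hA' a ha).2⟩) hq
    -- … and the strip `h ≤ |Im a| ≤ Hs` turns it into a count budget
    have hN' : ∀ A' : List ℂ, (∀ a ∈ A', g a = 0 ∧ |xs - a.re| < |a.im|) →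
        (∃ q : ℂ → ℂ, Differentiable ℂ q ∧ ∀ z, g z = (A'.map (fun a => z - a)).prod * q z) →
          A'.length ≤ ⌊Bw * Hs ^ 2⌋₊ := by
      intro A' hA' hq
      have hsum := hB' A' hA' hq
      cases A' with
      | nil => exact Nat.zero_le _
      | cons a₀ T =>
        set A' : List ℂ := a₀ :: T with hA'def
        have ha₀ : a₀ ∈ A' := by rw [hA'def]; exact List.mem_cons_self
        have hfl₀ : h ≤ |a₀.im| := hcon a₀ (hA' a₀ ha₀).1 (hA' a₀ ha₀).2
        have hst₀ : |a₀.im| ≤ Hs := abs_im_le_of_level hE' hgne (hA' a₀ ha₀).1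
        have hHs0 : 0 < Hs := lt_of_lt_of_le hh (hfl₀.trans hst₀)
        have hterm : ∀ y ∈ A'.map (fun a => 1 / a.im ^ 2), 1 / Hs ^ 2 ≤ y := by
          intro y hy
          obtain ⟨a, ha, rfl⟩ := List.mem_map.1 hy
          have hfl : h ≤ |a.im| := hcon a (hA' a ha).1 (hA' a ha).2
          have hst : |a.im| ≤ Hs := abs_im_le_of_level hE' hgne (hA' a ha).1
          have ha0 : 0 < |a.im| := lt_of_lt_of_le hh hfl
          have hsq : a.im ^ 2 ≤ Hs ^ 2 := by
            rw [← sq_abs a.im]; exact pow_le_pow_left₀ ha0.le hst 2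
          have ha2 : 0 < a.im ^ 2 := by rw [← sq_abs a.im]; positivity
          exact one_div_le_one_div_of_le ha2 hsq
        have hcard := List.card_nsmul_le_sum (A'.map (fun a => 1 / a.im ^ 2)) (1 / Hs ^ 2) hterm
        rw [List.length_map, nsmul_eq_mul] at hcard
        have hlen : (A'.length : ℝ) ≤ Bw * Hs ^ 2 := by
          have hHs2 : 0 < Hs ^ 2 := by positivity
          have := hcard.trans hsum
          rw [mul_one_div, div_le_iff₀ hHs2] at this
          exact this
        exact Nat.le_floor hlen
    have := jensenDip_quantWR hgd hρ'0 hρ' hgr' hgx hN' hB' Rm hRm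
    linarith
  obtain ⟨a, ha, hca, hah⟩ := hex
  have haim : a.im ≠ 0 := by
    intro h0; rw [h0, abs_zero] at hca; exact absurd hca (not_lt.2 (abs_nonneg _))
  obtain ⟨u, hu, hup, hure, huim⟩ := exists_upper_zero_of_nonreal hdiff hreal (j + 1) ha haim
  have huim' : u.im < h := by
    have : |u.im| < h := by rw [huim]; exact hah
    rwa [abs_of_pos hup] at this
  have hure' : |u.re - x₀| ≤ |xs - x₀| + h := by
    have h1 : |u.re - x₀| ≤ |xs - u.re| + |xs - x₀| := by
      have := abs_sub_le (u.re) xs x₀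
      rw [abs_sub_comm u.re xs] at this
      linarith
    have h2' : |xs - u.re| < |u.im| := by rw [hure, huim]; exact hca
    rw [abs_of_pos hup] at h2'
    linarith
  have hmax : max (|u.re - x₀| - R / 2) 0 ≤ max (|xs - x₀| + h - R / 2) 0 :=
    max_le_max (by linarith) le_rfl
  have hmax0 : 0 ≤ max (|u.re - x₀| - R / 2) 0 := le_max_right _ _
  have hsq1 : (max (|u.re - x₀| - R / 2) 0) ^ 2 ≤ (max (|xs - x₀| + h - R / 2) 0) ^ 2 :=
    pow_le_pow_left₀ hmax0 hmax 2
  have hsq2 : u.im ^ 2 ≤ h ^ 2 := by nlinarith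
  have hj0 : (0 : ℝ) ≤ (j : ℝ) + 1 := by positivity
  have hlat : (max (|u.re - x₀| - R / 2) 0) ^ 2 + (((j + 1 : ℕ) : ℝ)) * u.im ^ 2 ≤ (((j + 1 : ℕ) : ℝ)) * Hs ^ 2 := by
    push_cast
    nlinarith [mul_le_mul_of_nonneg_left hsq2 hj0]
  exact ⟨u, stTrkDQ_of_lateral hE' hgne hu hup hlat⟩

/-- **WEIGHTED EDGE-DIP SUCCESSOR** (no removed zeros): `succ_of_dip_edgeWR` with `Rm = []`; threshold `Bw·|m| < 2·|A|`.
(`succ_of_dip_edge` is the case `Bw = N/h²`.) -/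
theorem succ_of_dip_edgeW {η : ℝ} {f : ℂ → ℂ} {x₀ s hmax R Hs : ℝ} {B j : ℕ}
    (hE : EngineHyps5 2 η f x₀ s hmax R Hs B) {xs m A : ℝ}
    (hm : (m : ℂ) = iteratedDeriv (j + 1) f xs) (h2 : iteratedDeriv (j + 2) f xs = 0)
    (hA : ((2 * A : ℝ) : ℂ) = iteratedDeriv (j + 3) f xs) (hmA : 0 < m * A)
    {h : ℝ} (hh : 0 < h) {Bw : ℝ}
    (hB : ∀ L : List ℂ, (∀ a ∈ L, iteratedDeriv (j + 1) f a = 0 ∧ |xs - a.re| < |a.im| ∧ h ≤ |a.im|) →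
      (∃ q : ℂ → ℂ, Differentiable ℂ q ∧ ∀ z, iteratedDeriv (j + 1) f z = (L.map (fun a => z - a)).prod * q z) →
        (L.map (fun a => 1 / a.im ^ 2)).sum ≤ Bw)
    (hBm : Bw * |m| < 2 * |A|)
    (hwin : (max (|xs - x₀| + h - R / 2) 0) ^ 2 + ((j : ℝ) + 1) * h ^ 2 ≤ ((j : ℝ) + 1) * Hs ^ 2) :
    ∃ u : ℂ, StTrkDQ η f x₀ s hmax R Hs B (j + 1) u :=
  succ_of_dip_edgeWR hE hm h2 hA hmA hh hB []
    ⟨iteratedDeriv (j + 1) f, differentiable_iteratedDeriv_of_entire hE.1 (j + 1), fun z => by simp⟩ (by simpa using hBm) hwin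

end RhW08.Lens1Quant

end
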